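import Summits.QuantumAdvantage.QuantumAdvantage.Theorems.CubicForrelationNearExactIsExactKtThreeStructure
import Summits.QuantumAdvantage.QuantumAdvantage.Theorems.CubicForrelationNearExactIsExactTwelveOddWeightLight

/-!
# Crux `CubicForrelation.NearExactIsExact` (stmt-QuantumAdvantage-14043) — a cell with cubic form `T ⊕ T′` weighs at least `112`

Certificate seat `b2b-cforr-cert` (gen 41).  HONEST FRAMING: kernel-checked (standard axioms) weight bound used by the `T⊕T′` branch of
E1280-even (HOME/b2b-cforr-cert-g37/R2-PARTNER.md §2–3: "K–T weights < 128 of t̄ + RM(2,9) are … 112 for T⊕T′", so that a light triple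
`w₁ + w₂ + w₃ < 384` has all three cells `< 160` and cell lemma L3 (…CubicFormCellL3) applies to each).  Proof: a cubic `f` on `9` bits of
weight `< 128` is supported in an affine hyperplane or has weight `112` (Kasami–Tokura, `kt3_structure`); but a function vanishing on a
coset `x₀ ⊕ ker ℓ` of a hyperplane (or on everything) cannot have the cubic form `t̄ = s₀s₁s₂ ⊕ s₃s₄s₅`, because `ker ℓ` always contains
three vectors `a, b, c` with `t̄(a,b,c) = 1` (`tl3_coset_not_zero`, the same device as in …CubicFormCellL3).  Nothing about `θ₁₂`; NOT summit
progress.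

* `tl3_coset_not_zero`, `tl3_weight_ge`.

References: T. Kasami, N. Tokura (1970) Thm 1; R2-PARTNER.md §2.  Axioms: the standard three.
-/

set_option linter.dupNamespace false -- D-0017: single-problem summit ⇒ `QuantumAdvantage.QuantumAdvantage` by design

namespace Summit.QuantumAdvantage.QuantumAdvantage.Theorems.CubicForrelation.NearExactIsExact

open Finset
open Literature.Computability.QuantumComplexity
open Literature.Computability.QuantumComplexity.BuzetChailloux (bxor zeroVec bxor_comm bxor_self bxor_zeroVec zeroVec_bxor
  bxor_bxor_cancel_left)

/-- **No coset of a hyperplane kernel is a zero set of a `T⊕T′`-cell.**  If `f` has the cubic form of `s₀s₁s₂ ⊕ s₃s₄s₅` and vanishes on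
`x₀ ⊕ ker ℓ` for an additive `ℓ`, contradiction. [this work] -/
theorem tl3_coset_not_zero (f : (Fin 9 → Bool) → Bool)
    (hT : ∀ u v w x : Fin 9 → Bool,
      (((f x ^^ f (bxor x w)) ^^ (f (bxor x v) ^^ f (bxor (bxor x v) w))) ^^
          ((f (bxor x u) ^^ f (bxor (bxor x u) w)) ^^ (f (bxor (bxor x u) v) ^^ f (bxor (bxor (bxor x u) v) w)))) =
        (((((u 0 && (v 1 && w 2)) ^^ (u 0 && (v 2 && w 1))) ^^ ((u 1 && (v 0 && w 2)) ^^ (u 1 && (v 2 && w 0)))) ^^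
            ((u 2 && (v 0 && w 1)) ^^ (u 2 && (v 1 && w 0)))) ^^
         ((((u 3 && (v 4 && w 5)) ^^ (u 3 && (v 5 && w 4))) ^^ ((u 4 && (v 3 && w 5)) ^^ (u 4 && (v 5 && w 3)))) ^^
            ((u 5 && (v 3 && w 4)) ^^ (u 5 && (v 4 && w 3))))))
    (ℓ : (Fin 9 → Bool) → Bool) (hℓadd : ∀ x y, ℓ (bxor x y) = (ℓ x ^^ ℓ y)) (x₀ : Fin 9 → Bool)
    (hvan : ∀ s, ℓ s = false → f (bxor x₀ s) = false) : False := by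
  -- the third derivative at `x₀` in three directions of `ker ℓ` vanishes
  have hℓ0 : ℓ zeroVec = false := by
    have e := hℓadd zeroVec zeroVec; rw [bxor_self] at e; revert e; cases ℓ zeroVec <;> decide
  have hD3 : ∀ a b c, ℓ a = false → ℓ b = false → ℓ c = false →
      (((f x₀ ^^ f (bxor x₀ c)) ^^ (f (bxor x₀ b) ^^ f (bxor (bxor x₀ b) c))) ^^
          ((f (bxor x₀ a) ^^ f (bxor (bxor x₀ a) c)) ^^ (f (bxor (bxor x₀ a) b) ^^ f (bxor (bxor (bxor x₀ a) b) c)))) = false := by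
    intro a b c ha hb hc
    have h0 : f x₀ = false := by have := hvan zeroVec hℓ0; rwa [bxor_zeroVec] at this
    simp only [iw_bxor_assoc]
    rw [h0, hvan c hc, hvan b hb, hvan a ha, hvan _ (by rw [hℓadd, hb, hc]; rfl), hvan _ (by rw [hℓadd, ha, hc]; rfl),
      hvan _ (by rw [hℓadd, ha, hb]; rfl), hvan _ (by rw [hℓadd, ha, hℓadd, hb, hc]; rfl)]
    rfl
  set z : Fin 9 → Bool := fun i => ℓ (fun l => decide (l = i)) with hz
  have hzu : ∀ i : Fin 9, ℓ (fun l => decide (l = i)) = z i := fun i => rfl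
  by_cases h345 : z 3 = false ∧ z 4 = false ∧ z 5 = false
  · obtain ⟨h3, h4, h5⟩ := h345
    have e := hT (fun l => decide (l = 3)) (fun l => decide (l = 4)) (fun l => decide (l = 5)) x₀
    rw [hD3 _ _ _ (by rw [hzu]; exact h3) (by rw [hzu]; exact h4) (by rw [hzu]; exact h5)] at e
    revert e; decide
  · have hj : ∃ j : Fin 9, (j = 3 ∨ j = 4 ∨ j = 5) ∧ z j = true := by
      by_contra hno
      push Not at hno
      apply h345
      refine ⟨?_, ?_, ?_⟩
      · have := hno 3 (Or.inl rfl); revert this; cases z 3 <;> simp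
      · have := hno 4 (Or.inr (Or.inl rfl)); revert this; cases z 4 <;> simp
      · have := hno 5 (Or.inr (Or.inr rfl)); revert this; cases z 5 <;> simp
    obtain ⟨j, hj345, hzj⟩ := hj
    have hdir : ∀ t : Fin 9, ℓ (if z t = true then bxor (fun l => decide (l = t)) (fun l => decide (l = j))
        else fun l => decide (l = t)) = false := by
      intro t
      split_ifs with ht
      · rw [hℓadd, hzu, hzu, ht, hzj]; rfl
      · rw [hzu]; revert ht; cases z t <;> simp
    have e := hT (if z 0 = true then bxor (fun l => decide (l = 0)) (fun l => decide (l = j)) else fun l => decide (l = 0))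
      (if z 1 = true then bxor (fun l => decide (l = 1)) (fun l => decide (l = j)) else fun l => decide (l = 1))
      (if z 2 = true then bxor (fun l => decide (l = 2)) (fun l => decide (l = j)) else fun l => decide (l = 2)) x₀
    rw [hD3 _ _ _ (hdir 0) (hdir 1) (hdir 2)] at e
    revert e
    rcases hj345 with rfl | rfl | rfl <;> cases z 0 <;> cases z 1 <;> cases z 2 <;> decide

/-- **A `T⊕T′`-cell weighs at least `112`.**  See the module docstring. [this work; cite: KasamiTokura1970, Thm 1] -/
theorem tl3_weight_ge (f : (Fin 9 → Bool) → Bool) (hf : IsDegLeFun 3 f)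
    (hT : ∀ u v w x : Fin 9 → Bool,
      (((f x ^^ f (bxor x w)) ^^ (f (bxor x v) ^^ f (bxor (bxor x v) w))) ^^
          ((f (bxor x u) ^^ f (bxor (bxor x u) w)) ^^ (f (bxor (bxor x u) v) ^^ f (bxor (bxor (bxor x u) v) w)))) =
        (((((u 0 && (v 1 && w 2)) ^^ (u 0 && (v 2 && w 1))) ^^ ((u 1 && (v 0 && w 2)) ^^ (u 1 && (v 2 && w 0)))) ^^
            ((u 2 && (v 0 && w 1)) ^^ (u 2 && (v 1 && w 0)))) ^^
         ((((u 3 && (v 4 && w 5)) ^^ (u 3 && (v 5 && w 4))) ^^ ((u 4 && (v 3 && w 5)) ^^ (u 4 && (v 5 && w 3)))) ^^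
            ((u 5 && (v 3 && w 4)) ^^ (u 5 && (v 4 && w 3)))))) :
    112 ≤ #(univ.filter fun x : Fin 9 → Bool => f x = true) := by
  classical
  by_contra hlt
  push Not at hlt
  -- `f` is not identically zero
  have hpos : 0 < #(univ.filter fun x : Fin 9 → Bool => f x = true) := by
    rw [card_pos]
    by_contra hem
    rw [not_nonempty_iff_eq_empty, filter_eq_empty_iff] at hem
    have h0 : ∀ x, f x = false := fun x => by have := hem (mem_univ x); revert this; cases f x <;> simp
    exact tl3_coset_not_zero f hT (fun _ => false) (fun _ _ => rfl) zeroVec fun s _ => h0 _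
  rcases kt3_structure f hf hpos (by norm_num; omega) with ⟨z, b, hz, hsupp⟩ | hexc
  · -- supported in the hyperplane `⟨x, z⟩ = b`: take a base point off the hyperplane
    obtain ⟨i₀, hi₀⟩ : ∃ i, z i = true := by
      by_contra hno
      push Not at hno
      exact hz (funext fun i => by have := hno i; revert this; cases z i <;> simp [zeroVec])
    set ℓ : (Fin 9 → Bool) → Bool := fun x => decide (Odd #(univ.filter fun i => (x i && z i) = true)) with hℓ
    have hℓadd : ∀ x y, ℓ (bxor x y) = (ℓ x ^^ ℓ y) := fun x y => by
      simp only [hℓ]; exact tow_parity_bxor x y z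
    have hunit : ℓ (fun l => decide (l = i₀)) = true := by
      simp only [hℓ]
      have hs : (univ.filter fun i : Fin 9 => (decide (i = i₀) && z i) = true) = {i₀} := by
        ext i
        simp only [mem_filter, mem_univ, true_and, mem_singleton, Bool.and_eq_true, decide_eq_true_eq]
        constructor
        · exact fun h => h.1
        · rintro rfl; exact ⟨rfl, hi₀⟩
      rw [hs, card_singleton]; decide
    -- base point: `0` if `b = 1`, else `e_{i₀}`
    obtain ⟨x₁, hx₁⟩ : ∃ x₁, ℓ x₁ = !b := by
      cases b
      · exact ⟨fun l => decide (l = i₀), hunit⟩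
      · refine ⟨zeroVec, ?_⟩
        have e := hℓadd zeroVec zeroVec; rw [bxor_self] at e; revert e; cases ℓ zeroVec <;> decide
    refine tl3_coset_not_zero f hT ℓ hℓadd x₁ fun s hs => ?_
    by_contra hfs
    have hfs' : f (bxor x₁ s) = true := by revert hfs; cases f (bxor x₁ s) <;> simp
    have e := hsupp _ hfs'
    change ℓ (bxor x₁ s) = b at e
    rw [hℓadd, hs, hx₁] at e
    revert e; cases b <;> decide
  · omega

end Summit.QuantumAdvantage.QuantumAdvantage.Theorems.CubicForrelation.NearExactIsExact
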